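import Summits.Ventures.HSemireg.Mod4TwoSlopeSpectrumGeneral

/-!
# Venture HSemireg — MOD-4 line: h-parts VANISHING BELOW CODIMENSION `n` (`q_0 = ⋯ = q_{n-1} = 0`, `q_n ≠ 0`; the `ch(O_Z)`-shapes
# `q_n η_n + ⋯ + q_{2n} η_{2n}` of TABLE R): the MIDDLE Hankel matrix has full rank `n + 1`, `M_f(q)` is upper triangular with
# diagonal `(−1)ⁿ C(n,a)² q_n²`, so `dim ker(M_f(q) − t) = 0` off the finite set `t ∈ {(−1)ⁿ C(n,a)² q_n²}` (the generic MIDDLE DEGREE)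

HONEST FRAMING. Part of the Lean index of the computation cell `pub-hsemireg` (seat w3-mod4-1 gen 13, W3 SPECIAL FIBRES; file of
record `HOME/widen/W3/MOD4-OFFSPLIT-w3mod4.md` §8 TABLE R rows «q_n η_n + w» ∕ «ch(O_Z) generic»: middle entries `24` (`n = 2`),
`112` (`n = 3`) computed ×2, `480` (`n = 4`, kit j179422) ×1, with drops `22 ∕ 110 ∕ 478–479` on the loci `(w,w)_χ = 2Dq_n²`).
ELEMENTARY LINEAR ALGEBRA over a field ONLY: no abelian variety, no sheaf, no Ext group, no semiregularity map; nothing here says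
that HC / HC_CM / HC_AV holds; no Literature fact is declared; NO definition is introduced.

WHAT IS PROVED, for a sequence `q` with `q_m = 0` for all `m < n` and `q_n ≠ 0` (`q_{n+1}, …, q_{2n}` arbitrary):
* **`vecMul_hankel1_middle_eq_zero`** ∕ **`hankel1_rank_leading_middle`** — the square middle Hankel matrix `H_n(q) = (q_{i+s})_{i,s ≤ n}`
  is anti-lower-triangular with anti-diagonal `q_n`: `v ᵥ* H_n(q) = 0 ⇒ v = 0` (column `n − j` isolates `v_j` once `v_{>j}` vanish…
  read from column `0` upwards), hence `rank H_n(q) = n + 1`;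
* **`middleM_leading_apply_of_lt`** — `M_f(q)_{ab} = 0` for `b < a`; **`middleM_leading_apply_diag`** — `M_f(q)_{aa} = (−1)ⁿ C(n,a)² q_n²`;
* **`finrank_ker_middleM_leading`** — if `t ≠ (−1)ⁿ C(n,a)² q_n²` for every `a ≤ n`, then `dim ker(M_f(q) − t) = 0` (back
  substitution in the triangular system).
With FILE 13's `finrank_S_weilType_middle` this is the GENERIC middle degree `R_n = (n+3)C(2n,n) − 2(n+1)` of those rows for every
`n` (`WeilFrameLeadingTermMiddle`); ON the finite set of pins the drop (`1` or `2`) depends on the tail `q_{>n}` and is NOT treated.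
Everything PROVED, 0 sorry. Namespace `Summit.Ventures.HSemireg.Mod4`.
References: [BourbakiAlgebre1a3] Ch. III §8; [BuchweitzFlenner2008HH] Prop. 6.4.4 (why these matrices).
-/

namespace Summit.Ventures.HSemireg.Mod4

open Finset Matrix

variable {K : Type*} [Field K]

/-- **Anti-triangular middle Hankel matrix:** for `q_m = 0` (`m < n`) and `q_n ≠ 0`, `v ᵥ* H_n(q) = 0 ⇒ v = 0` — column `s`
of `v ᵥ* H_n(q)` is `Σ_i v_i q_{i+s}`; in column `n − a` the rows `i < a` contribute `0` and row `a` contributes `v_a q_n`, so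
`v_n, v_{n-1}, …, v_0` vanish in turn (induction from `a = n`, column `0`). [cite: BourbakiAlgebre1a3, Ch. III §8] -/
theorem vecMul_hankel1_middle_eq_zero {n : ℕ} {q : ℕ → K} (hq0 : ∀ m, m < n → q m = 0) (hqn : q n ≠ 0)
    {v : Fin (n + 1) → K} (hv : v ᵥ* Wedge.Hankel.hankel1 K (n + n) n q = 0) : v = 0 := by
  have hcol : ∀ s : ℕ, s < n + n + 1 - n → ∑ i : Fin (n + 1), v i * q ((i : ℕ) + s) = 0 := by
    intro s hs
    have h := congr_fun hv ⟨s, hs⟩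
    simpa [Matrix.vecMul, dotProduct, Wedge.Hankel.hankel1, Matrix.of_apply] using h
  -- `v (n - j) = 0` for `j = 0, …, n`, by strong induction on `j` (column `j`)
  have key : ∀ j, j ≤ n → v ⟨n - j, by omega⟩ = 0 := by
    intro j
    refine Nat.strong_induction_on j ?_
    intro j ih hj
    have h := hcol j (by omega)
    rw [Finset.sum_eq_single (⟨n - j, by omega⟩ : Fin (n + 1))] at h
    · have hidx : (n - j) + j = n := by omega
      rw [show ((⟨n - j, by omega⟩ : Fin (n + 1)) : ℕ) = n - j from rfl, hidx] at h
      exact (mul_eq_zero.mp h).resolve_right hqn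
    · intro i _ hi
      have hi' : (i : ℕ) ≠ n - j := fun h => hi (Fin.ext h)
      have hil := i.isLt
      by_cases hlt : n - j < (i : ℕ)
      · -- larger rows: zero by induction (`i = n - j'`, `j' < j`)
        have h' := ih (n - (i : ℕ)) (by omega) (by omega)
        have hfin : (⟨n - (n - (i : ℕ)), by omega⟩ : Fin (n + 1)) = i := Fin.ext (by simp only; omega)
        rw [hfin] at h'
        rw [h', zero_mul]
      · -- smaller rows: index `i + j < n`
        rw [hq0 _ (by omega), mul_zero]
    · intro h
      exact absurd (Finset.mem_univ _) h
  funext i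
  have hi := i.isLt
  have h := key (n - (i : ℕ)) (by omega)
  have hfin : (⟨n - (n - (i : ℕ)), by omega⟩ : Fin (n + 1)) = i := Fin.ext (by simp only; omega)
  rw [hfin] at h
  rw [h, Pi.zero_apply]

/-- **`rank H_n(q) = n + 1`** (the middle Hankel matrix is invertible) for `q_m = 0` (`m < n`), `q_n ≠ 0`.
[cite: BourbakiAlgebre1a3, Ch. III §8] -/
theorem hankel1_rank_leading_middle {n : ℕ} {q : ℕ → K} (hq0 : ∀ m, m < n → q m = 0) (hqn : q n ≠ 0) :
    (Wedge.Hankel.hankel1 K (n + n) n q).rank = n + 1 := by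
  set H := Wedge.Hankel.hankel1 K (n + n) n q with hH
  have hinj : Function.Injective (Hᵀ.mulVecLin) := by
    rw [← LinearMap.ker_eq_bot, LinearMap.ker_eq_bot']
    intro v hv
    rw [Matrix.mulVecLin_apply, Matrix.mulVec_transpose] at hv
    exact vecMul_hankel1_middle_eq_zero hq0 hqn hv
  rw [← Matrix.rank_transpose]
  change Module.finrank K ↥(LinearMap.range Hᵀ.mulVecLin) = n + 1
  rw [LinearMap.finrank_range_of_inj hinj, Module.finrank_fintype_fun_eq_card, Fintype.card_fin]

/-- **`M_f(q)` is upper triangular:** `M_f(q)_{ab} = 0` for `b < a` when `q_m = 0` for `m < n` (a non-zero product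
`q_{n-a+m} q_{n-m+b}` needs `a ≤ m ≤ b`). [cite: BourbakiAlgebre1a3, Ch. III §8] -/
theorem middleM_leading_apply_of_lt {n : ℕ} {q : ℕ → K} (hq0 : ∀ m, m < n → q m = 0) (a b : Fin (n + 1))
    (hba : (b : ℕ) < (a : ℕ)) : middleM n q a b = 0 := by
  have ha := a.isLt
  have hb := b.isLt
  simp only [middleM]
  refine mul_eq_zero_of_right _ (Finset.sum_eq_zero fun m _ => ?_)
  have hm := m.isLt
  by_cases h1 : (m : ℕ) < (a : ℕ)
  · rw [hq0 (n - (a : ℕ) + (m : ℕ)) (by omega), mul_zero, zero_mul]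
  · rw [hq0 (n - (m : ℕ) + (b : ℕ)) (by omega), mul_zero]

/-- **the diagonal of `M_f(q)`:** `M_f(q)_{aa} = (−1)ⁿ C(n,a)² q_n²` when `q_m = 0` for `m < n` (only `m = a` contributes).
[cite: BourbakiAlgebre1a3, Ch. III §8] -/
theorem middleM_leading_apply_diag {n : ℕ} {q : ℕ → K} (hq0 : ∀ m, m < n → q m = 0) (a : Fin (n + 1)) :
    middleM n q a a = (-1 : K) ^ n * ((n.choose (a : ℕ) : K) * (n.choose (a : ℕ) : K)) * (q n * q n) := by
  have ha := a.isLt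
  simp only [middleM]
  rw [Finset.sum_eq_single a]
  · have hidx : n - (a : ℕ) + (a : ℕ) = n := by omega
    rw [hidx, pow_add]
    have hsq : ((-1 : K) ^ (a : ℕ)) * ((-1 : K) ^ (a : ℕ)) = 1 := by
      rw [← pow_add, ← two_mul, pow_mul, neg_one_sq, one_pow]
    linear_combination ((-1 : K) ^ n * ((n.choose (a : ℕ) : K) * (n.choose (a : ℕ) : K)) * (q n * q n)) * hsq
  · intro m _ hm
    have hm' : (m : ℕ) ≠ (a : ℕ) := fun h => hm (Fin.ext h)
    have hml := m.isLt
    by_cases h1 : (m : ℕ) < (a : ℕ)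
    · rw [hq0 (n - (a : ℕ) + (m : ℕ)) (by omega), mul_zero, zero_mul]
    · rw [hq0 (n - (m : ℕ) + (a : ℕ)) (by omega), mul_zero]
  · intro h
    exact absurd (Finset.mem_univ _) h

/-- **generic middle degree:** if `t ≠ (−1)ⁿ C(n,a)² q_n²` for every `a ≤ n`, then `dim ker(M_f(q) − t) = 0` for `q_m = 0`
(`m < n`) — back substitution in the upper triangular system `(M_f(q) − t) v = 0` from the last row upwards.
[cite: BourbakiAlgebre1a3, Ch. III §8] -/
theorem finrank_ker_middleM_leading {n : ℕ} {q : ℕ → K} (hq0 : ∀ m, m < n → q m = 0) {t : K}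
    (ht : ∀ a, a ≤ n → t ≠ (-1 : K) ^ n * ((n.choose a : K) * (n.choose a : K)) * (q n * q n)) :
    Module.finrank K ↥(LinearMap.ker (Matrix.toLin' (middleM n q) - t • LinearMap.id)) = 0 := by
  rw [Submodule.finrank_eq_zero, LinearMap.ker_eq_bot']
  intro v hv
  -- row `a` of `(M - t) v = 0`: `Σ_b M_{ab} v_b - t v_a = 0`
  have hrow : ∀ a : Fin (n + 1), ∑ b : Fin (n + 1), middleM n q a b * v b - t * v a = 0 := by
    intro a
    have h := congr_fun hv a
    simpa [Matrix.toLin'_apply, Matrix.mulVec, dotProduct] using h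
  -- `v (n - j) = 0` by strong induction on `j`
  have key : ∀ j, j ≤ n → v ⟨n - j, by omega⟩ = 0 := by
    intro j
    refine Nat.strong_induction_on j ?_
    intro j ih hj
    set a : Fin (n + 1) := ⟨n - j, by omega⟩ with ha
    have h := hrow a
    rw [Finset.sum_eq_single a] at h
    · rw [middleM_leading_apply_diag hq0 a, ← sub_mul] at h
      rcases mul_eq_zero.mp h with h1 | h1
      · exact absurd (sub_eq_zero.mp h1).symm (ht (a : ℕ) (by simp only [ha]; omega))
      · exact h1
    · intro b _ hb
      have hbl := b.isLt
      by_cases hlt : (a : ℕ) < (b : ℕ)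
      · -- later unknowns already vanish
        have h' := ih (n - (b : ℕ)) (by simp only [ha] at hlt; omega) (by omega)
        have hfin : (⟨n - (n - (b : ℕ)), by omega⟩ : Fin (n + 1)) = b := Fin.ext (by simp only; omega)
        rw [hfin] at h'
        rw [h', mul_zero]
      · have hba : (b : ℕ) < (a : ℕ) := by
          have : (b : ℕ) ≠ (a : ℕ) := fun h => hb (Fin.ext h)
          omega
        rw [middleM_leading_apply_of_lt hq0 a b hba, zero_mul]
    · intro h
      exact absurd (Finset.mem_univ _) h
  funext i
  have hi := i.isLt
  have h := key (n - (i : ℕ)) (by omega)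
  have hfin : (⟨n - (n - (i : ℕ)), by omega⟩ : Fin (n + 1)) = i := Fin.ext (by simp only; omega)
  rw [hfin] at h
  rw [h, Pi.zero_apply]

end Summit.Ventures.HSemireg.Mod4
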